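import Literature.MathematicalPhysics.QuantumFieldTheory.Balaban1983to89.B4Eq19LatticeOperators
import Summits.QuantumFields.BalabanUV.Beta.BoxPoincare
import HarnessLib

/-!
# Route R of crux K1 «MinimiserStabilityRegPr» (stmt-QuantumFields-19200) — THE FABER–KRAHN INEQUALITY ON `ℤ^d` BY TILING:
# `Σ f² ≤ 4d·r(r−1)·Σ |∇f|²` whenever `4·#supp f ≤ r^d` (brick 2a of the flat linear interior-regularity core; cell `ym3-torus`,
# width seat `ym-ust-19200-w1` g6; OWNER ACK 22 (a); `--supports stmt-QuantumFields-19200 --as helper`, count-neutral)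

YM₃ on T³ is a RUNG of the ladder (R3), not the Clay problem; nothing here claims the stub, the crux or the gap.

WHY.  Brick 1 (`Prop7FlatInteriorMeanValue`) proves the `L² → L^∞` mean-value bound for lattice-HARMONIC data.  The sourced version at
the scaling the nonlinear passage needs (`sup|w| ≤ C·r·‖g‖_∞` for the box Dirichlet corrector of `−Δw = ∂*g`) is a De Giorgi ∕ Stampacchia
truncation argument whose one analytic input is a gain from small support — a Faber–Krahn inequality `λ₁^{Dir}(A) ≳ #A^{−2/d}`.  The cell's
`BalabanUV/Beta/LatticeFaberKrahn` proved it on the unit torus by TILING (no isoperimetry, no co-area, no Loomis–Whitney): tile by cubes of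
side `r` with `r^d ≥ 4·#supp f`; on each tile `Beta.BoxPoincare.sum_sq_le_energy_add_mean` gives `Σ_tile f² ≤ 2d·r(r−1)·E_tile + (2/r^d)(Σ_tile f)²`
and Cauchy–Schwarz `(Σ_tile f)² ≤ #supp·Σ_tile f² ≤ (r^d/4)·Σ_tile f²` absorbs the mean.  THIS FILE runs the same argument on `ℤ^d` in the letters of
the tree's Campanato road (`B4Eq19LatticeOperators`: `Zd`, `unitVec`, `fdiff`, `box`), where there is no wrap-around and hence no size condition.

WHAT IS PROVED (sorry-free, no definition; the tile chart is an explicit lambda `(q, v) ↦ a + (r·q + v)` on `Box d n₀ × Box d r`, abstracted in the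
lemmas as any chart `τ` with the step property `τ(q, v + e_i) = τ(q, v) + e_i`).
* §1 `energy_chart_le` (the in-tile `Beta.BoxPoincare.energy` of `f ∘ τ(q, ·)` is at most the lattice bond energy `Σ_v Σ_i (fdiff i f (τ(q,v)))²`),
  `sq_sum_le_card_mul_of_support` (Cauchy–Schwarz over the support), `tile_sum_sq_le` (per tile: `Σ_v f(τ(q,v))² ≤ 4d·r(r−1)·Σ_v Σ_i (fdiff i f (τ(q,v)))²`
  when `4·#S ≤ r^d`, `supp f ⊆ S`, `τ` injective), `sum_chart_le` (a nonnegative site function summed over the image of an injective chart is at most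
  its sum over any finset containing its support).
* §2 ★★ `faberKrahn` — for `f : ℤ^d → ℝ` vanishing off a finset `S`, any finset `T` containing every site at which some forward difference of `f` is
  nonzero, and every `r ≥ 1` with `4·#S ≤ r^d`: `Σ_{x ∈ S} f(x)² ≤ 4d·r(r−1)·Σ_{x ∈ T} Σ_i (fdiff i f x)²`.
  (The window and the tiling are built inside the proof from the bounding box of `S`.)

HONEST SCOPE.  [folklore] finite lattice calculus (the tiling proof of the discrete Faber–Krahn inequality; method pointers: Barlow, *Random Walks and
Heat Kernels on Graphs* (2017) §3.3; Grigor'yan's Faber–Krahn formulation of De Giorgi's iteration); a port of the idea of `Beta.LatticeFaberKrahn`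
(torus) to `ℤ^d`.  Nothing of Bałaban's is asserted; brick 2b (truncation + iteration) and 2c (assembly) are separate files.

References: M. Giaquinta, *Multiple integrals in the calculus of variations and nonlinear elliptic systems*, Princeton UP 1983 [Giaquinta1984] (Ch. III);
T. Bałaban, CMP 96 (1984) 223–250 [Balaban1984PropagatorsII] ((1.9) p.226 — the interior-regularity statement these lattice files serve).
-/

set_option autoImplicit false

noncomputable section

open scoped BigOperators
open Finset

namespace Summit.QuantumFields.YangMills.Theorems.Prop7FlatFaberKrahnZd

open Literature.MathematicalPhysics.QuantumFieldTheory.Balaban1983to89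
open B4Eq19LatticeOperators
open Summit.QuantumFields.BalabanUV.Beta.BoxPoincare (Box bd energy energy_nonneg sum_sq_le_energy_add_mean)

variable {d : ℕ}

/-! ## §1 Tiles: energy transport, absorption of the mean, the image count -/

/-- **Energy transport along a chart with the step property.**  If `τ(q, v + e_i) = τ(q, v) + e_i` whenever `v + e_i` stays in the tile, then
the in-tile energy of `f ∘ τ(q, ·)` is at most `Σ_v Σ_i (fdiff i f (τ(q,v)))²` (each in-tile difference IS a lattice forward difference; the far-face
terms are `0`). [folklore] -/
theorem energy_chart_le {n₀ r : ℕ} (τ : Box d n₀ × Box d r → Zd d)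
    (hτ : ∀ (q : Box d n₀) (v : Box d r) (i : Fin d) (h : (v i : ℕ) + 1 < r),
      τ (q, Function.update v i ⟨(v i : ℕ) + 1, h⟩) = τ (q, v) + unitVec i)
    (f : Zd d → ℝ) (q : Box d n₀) :
    energy (fun v : Box d r => f (τ (q, v))) ≤ ∑ v : Box d r, ∑ i : Fin d, fdiff i f (τ (q, v)) ^ 2 := by
  unfold energy
  refine Finset.sum_le_sum fun v _ => Finset.sum_le_sum fun i _ => ?_
  unfold bd
  split_ifs with hv
  · dsimp only
    rw [hτ q v i hv, fdiff_apply]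
  · rw [zero_pow two_ne_zero]; exact sq_nonneg _

/-- Cauchy–Schwarz over the support: `(Σ_v F v)² ≤ #{F ≠ 0}·Σ_v F v²`. [folklore] -/
theorem sq_sum_le_card_mul_of_support {ι : Type*} [Fintype ι] [DecidableEq ι] (F : ι → ℝ) :
    (∑ v, F v) ^ 2 ≤ ((univ.filter fun v => F v ≠ 0).card : ℝ) * ∑ v, F v ^ 2 := by
  classical
  set S := univ.filter fun v => F v ≠ 0 with hS
  have hsum : ∑ v, F v = ∑ v ∈ S, F v := by
    rw [hS, Finset.sum_filter]
    exact Finset.sum_congr rfl fun v _ => by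
      by_cases h : F v = 0
      · simp [h]
      · simp [h]
  have hsq : ∑ v ∈ S, F v ^ 2 ≤ ∑ v, F v ^ 2 :=
    Finset.sum_le_sum_of_subset_of_nonneg (Finset.subset_univ _) fun v _ _ => sq_nonneg _
  have hcs := Finset.sum_mul_sq_le_sq_mul_sq S (fun _ => (1 : ℝ)) F
  simp only [one_pow, one_mul, Finset.sum_const, nsmul_eq_mul, mul_one] at hcs
  rw [hsum]
  exact hcs.trans (mul_le_mul_of_nonneg_left hsq (Nat.cast_nonneg _))

/-- **Per tile, the mean is absorbed**: if `f` vanishes off a finset `S` with `4·#S ≤ r^d` and the chart `τ` is injective with the step property,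
then `Σ_v f(τ(q,v))² ≤ 4d·r(r−1)·Σ_v Σ_i (fdiff i f (τ(q,v)))²` (the two-term box Poincaré inequality `Beta.BoxPoincare.sum_sq_le_energy_add_mean`
plus Cauchy–Schwarz: the mean term is at most half the mass). [folklore] -/
theorem tile_sum_sq_le {n₀ r : ℕ} (hr : 1 ≤ r) (τ : Box d n₀ × Box d r → Zd d) (hinj : Function.Injective τ)
    (hτ : ∀ (q : Box d n₀) (v : Box d r) (i : Fin d) (h : (v i : ℕ) + 1 < r),
      τ (q, Function.update v i ⟨(v i : ℕ) + 1, h⟩) = τ (q, v) + unitVec i)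
    (f : Zd d → ℝ) (S : Finset (Zd d)) (hS : ∀ x, f x ≠ 0 → x ∈ S) (hA : 4 * S.card ≤ r ^ d) (q : Box d n₀) :
    ∑ v : Box d r, f (τ (q, v)) ^ 2 ≤
      4 * ((d : ℝ) * r * ((r : ℝ) - 1)) * ∑ v : Box d r, ∑ i : Fin d, fdiff i f (τ (q, v)) ^ 2 := by
  classical
  set F : Box d r → ℝ := fun v => f (τ (q, v)) with hF
  have hP := sum_sq_le_energy_add_mean F
  have hE := energy_chart_le τ hτ f q
  have hr0 : (0 : ℝ) < (r : ℝ) ^ d := by positivity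
  -- the support of `F` injects into `S`
  have hcard : ((univ.filter fun v => F v ≠ 0).card : ℝ) ≤ (S.card : ℝ) := by
    have hsub : (univ.filter fun v => F v ≠ 0).image (fun v => τ (q, v)) ⊆ S := by
      intro x hx
      rw [Finset.mem_image] at hx
      obtain ⟨v, hv, rfl⟩ := hx
      rw [Finset.mem_filter] at hv
      exact hS _ hv.2
    have hinj' : Set.InjOn (fun v : Box d r => τ (q, v)) ↑(univ.filter fun v => F v ≠ 0) := by
      intro v _ v' _ h
      have := hinj h
      simpa using this
    have h := Finset.card_le_card hsub
    rw [Finset.card_image_of_injOn hinj'] at h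
    exact_mod_cast h
  have hA' : 4 * (S.card : ℝ) ≤ (r : ℝ) ^ d := by exact_mod_cast hA
  -- the mean term is at most half the mass
  have hmean : 2 / (r : ℝ) ^ d * (∑ v, F v) ^ 2 ≤ (1 / 2) * ∑ v, F v ^ 2 := by
    have hcs := sq_sum_le_card_mul_of_support F
    have hS0 : 0 ≤ ∑ v, F v ^ 2 := Finset.sum_nonneg fun v _ => sq_nonneg _
    calc 2 / (r : ℝ) ^ d * (∑ v, F v) ^ 2 ≤ 2 / (r : ℝ) ^ d * (((univ.filter fun v => F v ≠ 0).card : ℝ) * ∑ v, F v ^ 2) :=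
          mul_le_mul_of_nonneg_left hcs (by positivity)
      _ ≤ 2 / (r : ℝ) ^ d * (((r : ℝ) ^ d / 4) * ∑ v, F v ^ 2) := by
          refine mul_le_mul_of_nonneg_left (mul_le_mul_of_nonneg_right ?_ hS0) (by positivity)
          linarith
      _ = (1 / 2) * ∑ v, F v ^ 2 := by field_simp; ring
  have hdr : 0 ≤ 2 * ((d : ℝ) * r * ((r : ℝ) - 1)) := by
    have : (1 : ℝ) ≤ r := by exact_mod_cast hr
    have : 0 ≤ (r : ℝ) - 1 := by linarith
    positivity
  have hmain : ∑ v, F v ^ 2 ≤ 2 * ((d : ℝ) * r * ((r : ℝ) - 1)) * energy F + (1 / 2) * ∑ v, F v ^ 2 := by linarith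
  have hfin : ∑ v, F v ^ 2 ≤ 4 * ((d : ℝ) * r * ((r : ℝ) - 1)) * energy F := by linarith
  exact hfin.trans (mul_le_mul_of_nonneg_left hE (by linarith))

/-- **Every lattice site carries at most one tile point**: a nonnegative site function summed over the points of an injective chart is at most its
sum over any finset containing the sites where it is nonzero. [folklore] -/
theorem sum_chart_le {ι : Type*} [Fintype ι] (τ : ι → Zd d) (hinj : Function.Injective τ) (G : Zd d → ℝ) (hG : ∀ x, 0 ≤ G x)
    (T : Finset (Zd d)) (hT : ∀ x, G x ≠ 0 → x ∈ T) :
    ∑ p, G (τ p) ≤ ∑ x ∈ T, G x := by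
  classical
  have h1 : ∑ p, G (τ p) = ∑ x ∈ (univ : Finset ι).image τ, G x :=
    (Finset.sum_image fun p _ p' _ h => hinj h).symm
  have h2 : ∑ x ∈ (univ : Finset ι).image τ, G x = ∑ x ∈ ((univ : Finset ι).image τ).filter (fun x => G x ≠ 0), G x :=
    (Finset.sum_filter_ne_zero _).symm
  have h3 : ((univ : Finset ι).image τ).filter (fun x => G x ≠ 0) ⊆ T := by
    intro x hx
    rw [Finset.mem_filter] at hx
    exact hT x hx.2
  rw [h1, h2]
  exact Finset.sum_le_sum_of_subset_of_nonneg h3 fun x _ _ => hG x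

/-! ## §2 The Faber–Krahn inequality on `ℤ^d` -/

/-- ★★ **THE LATTICE FABER–KRAHN INEQUALITY ON `ℤ^d`.**  If `f : ℤ^d → ℝ` vanishes off a finset `S`, `T` contains every site at which some
forward difference of `f` is nonzero, `r ≥ 1` and `4·#S ≤ r^d`, then
`Σ_{x ∈ S} f(x)² ≤ 4d·r(r−1)·Σ_{x ∈ T} Σ_i (fdiff i f x)²`
— i.e. the Dirichlet eigenvalue of a set of `#A` sites is `≥ (4d·r(r−1))⁻¹ ≳ #A^{−2/d}` for the best admissible `r`.  Proof: tile a window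
containing `S` by cubes of side `r` (chart `(q, v) ↦ a + r·q + v`, injective by Euclidean division), apply `tile_sum_sq_le` on each tile and count every
lattice site once (`sum_chart_le`). [folklore] -/
theorem faberKrahn {f : Zd d → ℝ} {S T : Finset (Zd d)} (hS : ∀ x, f x ≠ 0 → x ∈ S)
    (hT : ∀ (x : Zd d) (i : Fin d), fdiff i f x ≠ 0 → x ∈ T) {r : ℕ} (hr : 1 ≤ r) (hA : 4 * S.card ≤ r ^ d) :
    ∑ x ∈ S, f x ^ 2 ≤ 4 * ((d : ℝ) * r * ((r : ℝ) - 1)) * ∑ x ∈ T, ∑ i : Fin d, fdiff i f x ^ 2 := by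
  classical
  -- a bounding radius for `S`
  set R : ℕ := S.sup fun x => (univ : Finset (Fin d)).sup fun i => (x i).natAbs with hRdef
  have hR : ∀ x ∈ S, ∀ i, (x i).natAbs ≤ R := by
    intro x hx i
    have h1 : (x i).natAbs ≤ (univ : Finset (Fin d)).sup fun i => (x i).natAbs :=
      Finset.le_sup (f := fun i => (x i).natAbs) (Finset.mem_univ i)
    exact h1.trans (Finset.le_sup (f := fun x : Zd d => (univ : Finset (Fin d)).sup fun i => (x i).natAbs) hx)
  -- the window `a + [0, n₀ r)^d`, `a = −R·𝟙`, `n₀ = 2R + 1`, and its tile chart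
  set n₀ : ℕ := 2 * R + 1 with hn₀
  set a : Zd d := fun _ => -(R : ℤ) with ha
  set τ : Box d n₀ × Box d r → Zd d := fun p => a + fun i => ((r * (p.1 i : ℕ) + (p.2 i : ℕ) : ℕ) : ℤ) with hτ
  have hr0 : 0 < r := hr
  -- step property
  have hstep : ∀ (q : Box d n₀) (v : Box d r) (i : Fin d) (h : (v i : ℕ) + 1 < r),
      τ (q, Function.update v i ⟨(v i : ℕ) + 1, h⟩) = τ (q, v) + unitVec i := by
    intro q v i h
    funext j
    simp only [hτ, Pi.add_apply, unitVec, Pi.single_apply]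
    by_cases hj : j = i
    · subst hj
      simp only [Function.update_self, if_true]
      push_cast
      ring
    · simp only [Function.update_of_ne hj, if_neg hj, add_zero]
  -- injectivity (Euclidean division coordinatewise)
  have hinj : Function.Injective τ := by
    intro p p' h
    have hc : ∀ i, r * (p.1 i : ℕ) + (p.2 i : ℕ) = r * (p'.1 i : ℕ) + (p'.2 i : ℕ) := fun i => by
      have hi := congrFun h i
      simp only [hτ, Pi.add_apply, add_right_inj] at hi
      exact_mod_cast hi
    have hqv : ∀ i, (p.1 i : ℕ) = p'.1 i ∧ (p.2 i : ℕ) = p'.2 i := fun i => by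
      have h1 := hc i
      have hv := (p.2 i).2
      have hv' := (p'.2 i).2
      have hq : (r * (p.1 i : ℕ) + (p.2 i : ℕ)) / r = p.1 i := by
        rw [Nat.add_comm, Nat.add_mul_div_left _ _ hr0, Nat.div_eq_of_lt hv, Nat.zero_add]
      have hq' : (r * (p'.1 i : ℕ) + (p'.2 i : ℕ)) / r = p'.1 i := by
        rw [Nat.add_comm, Nat.add_mul_div_left _ _ hr0, Nat.div_eq_of_lt hv', Nat.zero_add]
      have hqq : (p.1 i : ℕ) = p'.1 i := by rw [← hq, ← hq', h1]
      refine ⟨hqq, ?_⟩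
      rw [hqq] at h1
      omega
    obtain ⟨q, v⟩ := p
    obtain ⟨q', v'⟩ := p'
    simp only [Prod.mk.injEq]
    exact ⟨funext fun i => Fin.ext (hqv i).1, funext fun i => Fin.ext (hqv i).2⟩
  -- `S` is covered by the tiles
  have hcover : ∀ x ∈ S, ∃ p, τ p = x := by
    intro x hx
    have hxi : ∀ i, 0 ≤ x i + R ∧ (x i + R).toNat < n₀ := fun i => by
      have := hR x hx i
      constructor <;> omega
    refine ⟨(fun i => ⟨(x i + R).toNat / r, lt_of_le_of_lt (Nat.div_le_self _ _) (hxi i).2⟩,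
      fun i => ⟨(x i + R).toNat % r, Nat.mod_lt _ hr0⟩), ?_⟩
    funext i
    simp only [hτ, ha, Pi.add_apply]
    have h1 : ((r * ((x i + R).toNat / r) + (x i + R).toNat % r : ℕ) : ℤ) = x i + R := by
      rw [Nat.div_add_mod]
      exact Int.toNat_of_nonneg (hxi i).1
    rw [h1]
    ring
  -- the left side lives on the image of the chart
  have hLHS : ∑ x ∈ S, f x ^ 2 ≤ ∑ p, f (τ p) ^ 2 := by
    have hsub : S ⊆ (univ : Finset (Box d n₀ × Box d r)).image τ := fun x hx => by
      obtain ⟨p, hp⟩ := hcover x hx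
      exact Finset.mem_image.mpr ⟨p, Finset.mem_univ _, hp⟩
    calc ∑ x ∈ S, f x ^ 2 ≤ ∑ x ∈ (univ : Finset (Box d n₀ × Box d r)).image τ, f x ^ 2 :=
          Finset.sum_le_sum_of_subset_of_nonneg hsub fun _ _ _ => sq_nonneg _
      _ = ∑ p, f (τ p) ^ 2 := Finset.sum_image fun p _ p' _ h => hinj h
  have hdr : 0 ≤ 4 * ((d : ℝ) * r * ((r : ℝ) - 1)) := by
    have : (1 : ℝ) ≤ r := by exact_mod_cast hr
    have : 0 ≤ (r : ℝ) - 1 := by linarith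
    positivity
  -- the bond-energy side: every site of the window is counted once
  have hG : ∑ p : Box d n₀ × Box d r, ∑ i : Fin d, fdiff i f (τ p) ^ 2 ≤ ∑ x ∈ T, ∑ i : Fin d, fdiff i f x ^ 2 := by
    refine sum_chart_le τ hinj (fun x => ∑ i : Fin d, fdiff i f x ^ 2) (fun x => Finset.sum_nonneg fun _ _ => sq_nonneg _) T
      fun x hx => ?_
    by_contra hxT
    refine hx (Finset.sum_eq_zero fun i _ => ?_)
    have : fdiff i f x = 0 := by
      by_contra hne
      exact hxT (hT x i hne)
    rw [this]; ring
  calc ∑ x ∈ S, f x ^ 2 ≤ ∑ p, f (τ p) ^ 2 := hLHS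
    _ = ∑ q : Box d n₀, ∑ v : Box d r, f (τ (q, v)) ^ 2 := Fintype.sum_prod_type _
    _ ≤ ∑ q : Box d n₀, 4 * ((d : ℝ) * r * ((r : ℝ) - 1)) * ∑ v : Box d r, ∑ i : Fin d, fdiff i f (τ (q, v)) ^ 2 :=
        Finset.sum_le_sum fun q _ => tile_sum_sq_le hr τ hinj hstep f S hS hA q
    _ = 4 * ((d : ℝ) * r * ((r : ℝ) - 1)) * ∑ p : Box d n₀ × Box d r, ∑ i : Fin d, fdiff i f (τ p) ^ 2 := by
        rw [← Finset.mul_sum, Fintype.sum_prod_type]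
    _ ≤ 4 * ((d : ℝ) * r * ((r : ℝ) - 1)) * ∑ x ∈ T, ∑ i : Fin d, fdiff i f x ^ 2 := mul_le_mul_of_nonneg_left hG hdr

end Summit.QuantumFields.YangMills.Theorems.Prop7FlatFaberKrahnZd

end
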